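import Literature.Claims.NS.Thambynayagam2015
import Literature.Analysis.FluidPDE.ParallelShearFlow
import Literature.Analysis.FluidPDE.FirstIntegralTransportDefect
import HarnessLib

/-!
# C38 `Thambynayagam2015` — `PlateauReached` is FALSE: the §4 «instantaneous sequence» of a drifted shear
# mode never plateaus — Part 1 (KIT: slice calculus, datum, trigonometric profiles). ADDENDUM to ADJUDICATED
# #55; UG CROSS-CHECK v1.31c (5) / RULINGS v1.31f (1); countermodel refuter-7 g2, kernel salvage-p5 g2

Witness: `κ = 1`, datum `v⁰(x) = cos(2πx₁) e₀ + c e₁` (`c = 1`: a transverse shear mode carried by a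
Galilean drift along the shear coordinate; smooth, divergence free, `ℤ³`-periodic — `IsDatum`; its inertial
term `(v⁰·∇)v⁰ = −2πc sin(2πx₁) e₀` is not a periodic gradient — `¬ InertialPartVanishes`). ALL Picard levels
of §4 are closed-form drift–shear fields `V l t x = φ_l(t,x₁) e₀ + c e₁`,
`φ_l(t,s) = a_l(t) cos(2πs) + b_l(t) sin(2πs)`, with complex amplitude
`a_l + i b_l = Z_l(t) = e^{−4π²κt} Σ_{m<l} (2πict)^m/m!` (`l ≥ 1`; `Z_0 ≡ 1`): the truncated Taylor series
of the drifted decaying wave `e^{−4π²κt} e^{2πict}`. Inertial terms `𝓤⁽ˡ⁾ = c ∂ₛφ_l(t,x₁) e₀`, potentials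
`P ≡ 0`; `IsSequence` holds level by level (`Z_{l+1}' = −4π²κ Z_{l+1} + 2πic Z_l`, `Z_{l+1}(0) = 1`).
A plateau `𝓤⁽ᵏ⁾ = 𝓤⁽ᵏ⁻¹⁾` on `t ≥ 0` (`k ≥ 2`) would give `Z_k(1) = Z_{k−1}(1)`, i.e.
`e^{−4π²κ}(2πic)^{k−1}/(k−1)! = 0` — impossible for `c ≠ 0`. Hence `not_PlateauReached` (in Part 2, `SoloRefuteThambynayagam2015Plateau.lean`, which imports this file and carries
the amplitudes, the levels and the non-plateau argument).

Part 1: slice calculus of drift–shear fields on the tree's `ParallelShear` lemmas (p484187): `(W·∇)W = cψ′e₀`,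
`div W = 0`, `ΔW = ψ″e₀`, periodicity, `IsInertialPart` with potential `0`, the datum and
`not_inertialPartVanishes_datum` (mean-value argument along `s ↦ (s,¼,0)`).
Part 2: trigonometric profiles, the amplitudes (`taylorI`, `coef`, `aCoef`, `bCoef`) with their ODEs, the
levels `V`, `U`, `P`, `isSequence`, `U_succ_ne`, `not_PlateauReached`.

WHAT THIS IS NOT: not a claim about NS regularity or blow-up; not a claim about any author beyond the typed
locator.
-/

noncomputable section

open Set Function InnerProductSpace
open scoped ContDiff Laplacian InnerProductSpace RealInnerProductSpace Topology

set_option linter.dupNamespace false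

namespace Summit.NavierStokesRegularity.NavierStokesRegularity.Theorems.Thambynayagam2015.Plateau

open Literature.Analysis.FluidPDE Literature.Analysis.FluidPDE.ParallelShear Literature.Claims.NS
  Literature.Claims.NS.Thambynayagam2015

/-- `ℝ³`. -/
abbrev E3 : Type := EuclideanSpace ℝ (Fin 3)

/-- `e₀`. -/
abbrev e0 : E3 := EuclideanSpace.single (0 : Fin 3) (1 : ℝ)
/-- `e₁`. -/
abbrev e1 : E3 := EuclideanSpace.single (1 : Fin 3) (1 : ℝ)

/-- The drift–shear field `W_{c,ψ}(x) = ψ(x₁) e₀ + c e₁`. -/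
def driftShear (c : ℝ) (ψ : ℝ → ℝ) (x : E3) : E3 := ψ (x 1) • e0 + c • e1

/-- `driftShear_eq` (C38 plateau kit; see the module docstring). -/
theorem driftShear_eq (c : ℝ) (ψ : ℝ → ℝ) :
    driftShear c ψ = fun x : E3 => ψ (x 1) • e0 + c • e1 := rfl

/-- `(W x)₁ = c` (the drift component). -/
theorem driftShear_apply_one (c : ℝ) (ψ : ℝ → ℝ) (x : E3) : driftShear c ψ x 1 = c := by
  simp [driftShear]

/-- `(W x)₀ = ψ(x₁)`. -/
theorem driftShear_apply_zero (c : ℝ) (ψ : ℝ → ℝ) (x : E3) : driftShear c ψ x 0 = ψ (x 1) := by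
  simp [driftShear]

/-- The derivative of `W_{c,ψ}`: `v ↦ v₁ ψ′(x₁) e₀` (the drift is constant). -/
theorem hasFDerivAt_driftShear (c : ℝ) {ψ : ℝ → ℝ} {x : E3} {d : ℝ} (hψ : HasDerivAt ψ d (x 1)) :
    HasFDerivAt (driftShear c ψ)
      ((EuclideanSpace.proj (1 : Fin 3) : E3 →L[ℝ] ℝ).smulRight (d • e0)) x := by
  have h := (hasFDerivAt_profile (ψ := ψ) (y := x) hψ).add_const (c • e1)
  simpa [driftShear_eq] using h

/-- `(W·∇)W = c ψ′(x₁) e₀`. -/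
theorem convect_driftShear (c : ℝ) {ψ : ℝ → ℝ} {x : E3} (hψ : DifferentiableAt ℝ ψ (x 1)) :
    convect (driftShear c ψ) (driftShear c ψ) x = (c * deriv ψ (x 1)) • e0 := by
  rw [convect_apply, (hasFDerivAt_driftShear c hψ.hasDerivAt).fderiv]
  simp [driftShear, smul_smul, mul_comm c]

/-- `div W = 0`. -/
theorem divergence_driftShear (c : ℝ) {ψ : ℝ → ℝ} {x : E3} (hψ : DifferentiableAt ℝ ψ (x 1)) :
    VectorCalculus.divergence (driftShear c ψ) x = 0 := by
  rw [divergence_eq_sum_inner_fderiv (EuclideanSpace.basisFun (Fin 3) ℝ),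
    (hasFDerivAt_driftShear c hψ.hasDerivAt).fderiv]
  simp [Fin.sum_univ_three, EuclideanSpace.inner_single_left]

/-- `isDivFree_driftShear` (C38 plateau kit; see the module docstring). -/
theorem isDivFree_driftShear (c : ℝ) {ψ : ℝ → ℝ} (hψ : Differentiable ℝ ψ) :
    VectorCalculus.IsDivFree (driftShear c ψ) := fun _ => divergence_driftShear c (hψ _)

/-- `isDivFree_driftShear'` (C38 plateau kit; see the module docstring). -/
theorem isDivFree_driftShear' (c : ℝ) {ψ : ℝ → ℝ} (hψ : Differentiable ℝ ψ) :
    NSWave0.IsDivFree (driftShear c ψ) := fun _ => divergence_driftShear c (hψ _)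

/-- `ΔW = ψ″(x₁) e₀`. -/
theorem laplacian_driftShear (c : ℝ) {ψ : ℝ → ℝ} (hψ : ContDiff ℝ 2 ψ) (x : E3) :
    Δ (driftShear c ψ) x = deriv (deriv ψ) (x 1) • e0 := by
  have hd : Differentiable ℝ ψ := hψ.differentiable (by norm_num)
  -- the drift is constant: `DW = D(ψ(x₁)e₀)` everywhere, hence the Laplacians agree
  have hfd : fderiv ℝ (driftShear c ψ) = fderiv ℝ (fun z : E3 => ψ (z 1) • e0) := by
    funext y
    rw [(hasFDerivAt_driftShear c (hd (y 1)).hasDerivAt).fderiv,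
      (hasFDerivAt_profile (hd (y 1)).hasDerivAt).fderiv]
  rw [← laplacian_profile hψ x, laplacian_eq_sum_fderiv_fderiv_curried (EuclideanSpace.basisFun (Fin 3) ℝ),
    laplacian_eq_sum_fderiv_fderiv_curried (EuclideanSpace.basisFun (Fin 3) ℝ), hfd]

/-- `W` is smooth when `ψ` is. -/
theorem contDiff_driftShear (c : ℝ) {ψ : ℝ → ℝ} {n : WithTop ℕ∞} (hψ : ContDiff ℝ n ψ) :
    ContDiff ℝ n (driftShear c ψ) :=
  ((hψ.comp (EuclideanSpace.proj (1 : Fin 3) : E3 →L[ℝ] ℝ).contDiff).smul contDiff_const).add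
    contDiff_const

/-- `ℤ³`-periodicity for a `1`-periodic profile. -/
theorem isLatticePeriodic_driftShear (c : ℝ) {ψ : ℝ → ℝ} (hper : ∀ s, ψ (s + 1) = ψ s) :
    IsLatticePeriodic (driftShear c ψ) := by
  intro j x
  simp only [driftShear, PiLp.add_apply, PiLp.single_apply]
  by_cases hj : (1 : Fin 3) = j
  · subst hj; simp [hper]
  · simp [hj]

/-- The INERTIAL PART of `W_{c,ψ}` is `𝓤 = c ψ′(x₁) e₀` with potential `0` (it is divergence free
and periodic by itself, so the Helmholtz gradient part vanishes). -/
theorem isInertialPart_driftShear (c : ℝ) {ψ : ℝ → ℝ} (hψ : ContDiff ℝ ∞ ψ)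
    (hper' : ∀ s, deriv ψ (s + 1) = deriv ψ s) :
    IsInertialPart (driftShear c ψ) (fun x : E3 => (c * deriv ψ (x 1)) • e0) (fun _ => 0) := by
  have hd : Differentiable ℝ ψ := hψ.differentiable (by simp)
  have hd' : ContDiff ℝ ∞ (deriv ψ) := hψ.iterate_deriv 1
  refine ⟨contDiff_const, fun j x => rfl, ?_, ?_, fun x => ?_⟩
  · -- periodic
    intro j x
    simp only [PiLp.add_apply, PiLp.single_apply]
    by_cases hj : (1 : Fin 3) = j
    · subst hj; simp [hper']
    · simp [hj]
  · -- divergence free: it is itself a profile field `(c ψ′)(x₁) e₀`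
    intro x
    exact divergence_profile (ψ := fun s => c * deriv ψ s) (x := x)
      ((hd'.differentiable (by simp)).differentiableAt.const_mul c)
  · rw [convect_driftShear c (hd _)]
    simp

/-! ### The datum `v⁰ = cos(2πx₁) e₀ + c e₁` -/

/-- The datum profile. -/
def cosProfile (s : ℝ) : ℝ := Real.cos (2 * Real.pi * s)

/-- `hasDerivAt_cosProfile` (C38 plateau kit; see the module docstring). -/
theorem hasDerivAt_cosProfile (s : ℝ) :
    HasDerivAt cosProfile (-(2 * Real.pi) * Real.sin (2 * Real.pi * s)) s := by
  unfold cosProfile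
  exact (((hasDerivAt_id s).const_mul (2 * Real.pi)).cos).congr_deriv (by simp; ring)

/-- `deriv_cosProfile` (C38 plateau kit; see the module docstring). -/
theorem deriv_cosProfile (s : ℝ) : deriv cosProfile s = -(2 * Real.pi) * Real.sin (2 * Real.pi * s) :=
  (hasDerivAt_cosProfile s).deriv

/-- `contDiff_cosProfile` (C38 plateau kit; see the module docstring). -/
theorem contDiff_cosProfile : ContDiff ℝ ∞ cosProfile := by
  unfold cosProfile; fun_prop

/-- `cosProfile_periodic` (C38 plateau kit; see the module docstring). -/
theorem cosProfile_periodic (s : ℝ) : cosProfile (s + 1) = cosProfile s := by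
  simp only [cosProfile]
  rw [mul_add, mul_one]
  exact Real.cos_add_two_pi _

/-- The datum. -/
def datum (c : ℝ) : E3 → E3 := driftShear c cosProfile

/-- `isDatum_datum` (C38 plateau kit; see the module docstring). -/
theorem isDatum_datum (c : ℝ) : IsDatum (datum c) :=
  ⟨contDiff_driftShear c contDiff_cosProfile,
    isDivFree_driftShear' c (contDiff_cosProfile.differentiable (by simp)),
    isLatticePeriodic_driftShear c cosProfile_periodic⟩

/-- For `c ≠ 0` the datum's inertial term `−2πc sin(2πx₁) e₀` is NOT a periodic gradient. -/
theorem not_inertialPartVanishes_datum {c : ℝ} (hc : c ≠ 0) : ¬ InertialPartVanishes (datum c) := by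
  rintro ⟨p₀, hp_smooth, hp_per, -, -, hconv⟩
  -- `∇p₀(x) = −(W·∇)W(x) = 2πc sin(2πx₁) e₀`; along the line `s ↦ (s, 1/4, 0)` the derivative of `p₀` is the
  -- constant `2πc`, contradicting `p₀(x + e₀) = p₀(x)`.
  have hd : Differentiable ℝ cosProfile := contDiff_cosProfile.differentiable (by simp)
  set x0 : E3 := EuclideanSpace.single (1 : Fin 3) (1 / 4 : ℝ) with hx0
  have hgrad : ∀ s : ℝ, gradient p₀ (x0 + s • e0) = (2 * Real.pi * c) • e0 := by
    intro s
    have h := hconv (x0 + s • e0)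
    rw [datum, convect_driftShear c (hd _)] at h
    have h1 : (x0 + s • e0) 1 = 1 / 4 := by simp [hx0]
    rw [h1, deriv_cosProfile] at h
    have hsin : Real.sin (2 * Real.pi * (1 / 4)) = 1 := by
      rw [show 2 * Real.pi * (1 / 4 : ℝ) = Real.pi / 2 by ring]; exact Real.sin_pi_div_two
    rw [hsin] at h
    -- h : (c * (-(2π) * 1)) • e0 = 0 - gradient p₀ _   (U = 0 for the datum's vanishing test)
    have : gradient p₀ (x0 + s • e0) = -((c * (-(2 * Real.pi) * 1)) • e0) := by
      rw [h]; simp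
    rw [this, ← neg_smul]; congr 1; ring
  -- derivative of `s ↦ p₀ (x0 + s e0)` is `⟪∇p₀, e0⟫ = 2πc`
  have hline : ∀ s : ℝ, HasDerivAt (fun σ : ℝ => p₀ (x0 + σ • e0)) (2 * Real.pi * c) s := by
    intro s
    have hp : HasFDerivAt p₀ (fderiv ℝ p₀ (x0 + s • e0)) (x0 + s • e0) :=
      ((hp_smooth.differentiable (by simp)) _).hasFDerivAt
    have hγ : HasDerivAt (fun σ : ℝ => x0 + σ • e0) e0 s := by
      simpa using ((hasDerivAt_id s).smul_const e0).const_add x0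
    have hcomp := hp.comp_hasDerivAt s hγ
    have hval : (fderiv ℝ p₀ (x0 + s • e0)) e0 = 2 * Real.pi * c := by
      have h1 : (fderiv ℝ p₀ (x0 + s • e0)) e0 = ⟪gradient p₀ (x0 + s • e0), e0⟫ := by
        simp only [gradient, InnerProductSpace.toDual_symm_apply]
      rw [h1, hgrad s, real_inner_smul_left]
      simp
    have h2 := hcomp
    simp only [Function.comp_def, hval] at h2
    exact h2
  -- hence `p₀(x0 + e0) − p₀(x0) = 2πc ≠ 0`, contradicting periodicity in `e₀`
  have hmvt : p₀ (x0 + (1 : ℝ) • e0) - p₀ (x0 + (0 : ℝ) • e0) = 2 * Real.pi * c := by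
    have key : ∀ s : ℝ, p₀ (x0 + s • e0) = p₀ (x0 + (0:ℝ) • e0) + 2 * Real.pi * c * s := by
      intro s
      have hF : ∀ σ, HasDerivAt (fun σ : ℝ => p₀ (x0 + σ • e0) - 2 * Real.pi * c * σ) 0 σ := by
        intro σ
        have := (hline σ).fun_sub ((hasDerivAt_id σ).const_mul (2 * Real.pi * c))
        simpa using this
      have hconst := is_const_of_deriv_eq_zero (fun σ => (hF σ).differentiableAt) (fun σ => (hF σ).deriv) s 0
      simp only [mul_zero, sub_zero] at hconst
      linarith
    have := key 1
    simp only [mul_one] at this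
    linarith
  have hper0 : p₀ (x0 + (1 : ℝ) • e0) = p₀ (x0 + (0 : ℝ) • e0) := by
    simpa using hp_per 0 x0
  rw [hper0, sub_self] at hmvt
  have : (2 * Real.pi * c) ≠ 0 := by positivity
  exact this hmvt.symm

/-! ## Part 2 — the Picard levels (closed form), the sequence, and non-plateau -/

/-! ### Trigonometric profiles `a cos(2πs) + b sin(2πs)` -/

/-- `trig a b s = a cos(2πs) + b sin(2πs)`. -/
def trig (a b : ℝ) (s : ℝ) : ℝ := a * Real.cos (2 * Real.pi * s) + b * Real.sin (2 * Real.pi * s)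

/-- `hasDerivAt_trig` (C38 plateau kit; see the module docstring). -/
theorem hasDerivAt_trig (a b s : ℝ) :
    HasDerivAt (trig a b) (trig (2 * Real.pi * b) (-(2 * Real.pi * a)) s) s := by
  unfold trig
  have hc := ((hasDerivAt_id s).const_mul (2 * Real.pi)).cos.const_mul a
  have hs := ((hasDerivAt_id s).const_mul (2 * Real.pi)).sin.const_mul b
  exact (hc.add hs).congr_deriv (by simp; ring)

/-- `deriv_trig` (C38 plateau kit; see the module docstring). -/
theorem deriv_trig (a b : ℝ) : deriv (trig a b) = trig (2 * Real.pi * b) (-(2 * Real.pi * a)) :=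
  funext fun s => (hasDerivAt_trig a b s).deriv

/-- `deriv_deriv_trig` (C38 plateau kit; see the module docstring). -/
theorem deriv_deriv_trig (a b s : ℝ) : deriv (deriv (trig a b)) s = -(4 * Real.pi ^ 2) * trig a b s := by
  rw [deriv_trig, deriv_trig]; simp [trig]; ring

/-- `contDiff_trig` (C38 plateau kit; see the module docstring). -/
theorem contDiff_trig (a b : ℝ) {n : WithTop ℕ∞} : ContDiff ℝ n (trig a b) := by
  unfold trig; fun_prop

/-- `trig_periodic` (C38 plateau kit; see the module docstring). -/
theorem trig_periodic (a b s : ℝ) : trig a b (s + 1) = trig a b s := by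
  simp only [trig]
  rw [mul_add, mul_one, Real.cos_add_two_pi, Real.sin_add_two_pi]

/-- `trig_zero` (C38 plateau kit; see the module docstring). -/
theorem trig_zero (a b : ℝ) : trig a b 0 = a := by simp [trig]

/-- `trig_quarter` (C38 plateau kit; see the module docstring). -/
theorem trig_quarter (a b : ℝ) : trig a b (1 / 4) = b := by
  have h : 2 * Real.pi * (1 / 4 : ℝ) = Real.pi / 2 := by ring
  simp only [trig]
  rw [h, Real.cos_pi_div_two, Real.sin_pi_div_two]
  ring

/-- `trig_one_zero` (C38 plateau kit; see the module docstring). -/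
theorem trig_one_zero : trig 1 0 = cosProfile := by
  funext s; simp [trig, cosProfile]

end Summit.NavierStokesRegularity.NavierStokesRegularity.Theorems.Thambynayagam2015.Plateau

end
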